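import Mathlib
import HarnessLib

/-!
# The symmetric point of an inversion-closed weight family (solo-blind programme, Theorem 25, part 3)

For the elementary symmetric sums `e_j(x; s) = ∑_{T ⊆ s, #T = j} ∏_{k∈T} x_k` of nonzero real
weights:

* `esy_card_sub_eq` : the complement bijection `T ↦ s ∖ T` gives
  `e_{#s - j}(x) = (∏_s x) · e_j(x⁻¹)`;
* `esy_inv_eq_of_pairing` : if a permutation `τ` preserves `s` and inverts the weights on it
  (`x_{τ k} = x_k⁻¹`), then `e_j(x⁻¹; s) = e_j(x; s)` and `∏_s x = 1` (positive weights);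
* `esy_card_sub_eq_of_pairing`, `esy_symmetric_point` : hence `e_{#s - j} = e_j`, and for
  `#s = 2m` the point `m` is SYMMETRIC: `e_{m-1} = e_{m+1}`.

This is hypothesis (d) of the fugacity window (`SoloBlindCanonicalVariance.fugacity_window`) for
the number-projected BCS state built from reciprocal weights on matched modes below / above the
Fermi level (report §5.20 (6), item E4a of the plan for claim C53). [this work; elementary]
-/

namespace Summit.HubbardSuperconductivity.HubbardSuperconductivity.Theorems.CanonicalOccupation

open Finset

variable {α : Type*} [DecidableEq α]

/-- `esy[x, s, j]` = the `j`-th elementary symmetric sum of the weights `x` over the modes `s`. -/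
local notation "esy[" x ", " s ", " j "]" =>
  (∑ t ∈ Finset.powersetCard j s, ∏ k ∈ t, x k)

/-- COMPLEMENT BIJECTION: `e_{#s-j}(x; s) = (∏_{k∈s} x_k) · e_j(x⁻¹; s)` for nonzero weights and
`j ≤ #s`. [folklore] -/
theorem esy_card_sub_eq (x : α → ℝ) (s : Finset α) (hx : ∀ k ∈ s, x k ≠ 0) {j : ℕ}
    (hj : j ≤ s.card) :
    esy[x, s, s.card - j] = (∏ k ∈ s, x k) * esy[fun k => (x k)⁻¹, s, j] := by
  rw [mul_sum]
  refine sum_nbij' (fun T => s \ T) (fun T => s \ T) ?_ ?_ ?_ ?_ ?_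
  · intro T hT
    rw [mem_powersetCard] at hT ⊢
    refine ⟨sdiff_subset, ?_⟩
    rw [card_sdiff_of_subset hT.1, hT.2]
    omega
  · intro T hT
    rw [mem_powersetCard] at hT ⊢
    refine ⟨sdiff_subset, ?_⟩
    rw [card_sdiff_of_subset hT.1, hT.2]
  · intro T hT
    rw [mem_powersetCard] at hT
    exact Finset.sdiff_sdiff_eq_self hT.1
  · intro T hT
    rw [mem_powersetCard] at hT
    exact Finset.sdiff_sdiff_eq_self hT.1
  · intro T hT
    rw [mem_powersetCard] at hT
    have hsub : s \ T ⊆ s := sdiff_subset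
    -- `∏_s x = ∏_{s \ (s \ T)} x * ∏_{s \ T} x = ∏_T x * ∏_{s\T} x`
    rw [← prod_sdiff hsub, Finset.sdiff_sdiff_eq_self hT.1, mul_assoc, ← prod_mul_distrib,
      prod_eq_one (fun k hk => mul_inv_cancel₀ (hx k (hsub hk))), mul_one]

omit [DecidableEq α] in
/-- A permutation preserving `s` maps `s` onto itself. [folklore] -/
theorem map_perm_eq_self {s : Finset α} (τ : Equiv.Perm α) (hτs : ∀ k ∈ s, τ k ∈ s) :
    s.map τ.toEmbedding = s := by
  apply eq_of_subset_of_card_le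
  · intro k hk
    obtain ⟨k', hk', rfl⟩ := mem_map.1 hk
    exact hτs k' hk'
  · rw [card_map]

omit [DecidableEq α] in
/-- REINDEXING BY AN INVERTING PERMUTATION: if `τ` preserves `s` and `x_{τ k} = x_k⁻¹` on `s`,
then `e_j(x⁻¹; s) = e_j(x; s)`. [this work; elementary] -/
theorem esy_inv_eq_of_pairing (x : α → ℝ) (s : Finset α) (τ : Equiv.Perm α)
    (hτs : ∀ k ∈ s, τ k ∈ s) (hτx : ∀ k ∈ s, x (τ k) = (x k)⁻¹) (j : ℕ) :
    esy[fun k => (x k)⁻¹, s, j] = esy[x, s, j] := by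
  have hmap := map_perm_eq_self τ hτs
  calc esy[fun k => (x k)⁻¹, s, j] = ∑ t ∈ powersetCard j s, ∏ k ∈ t, x (τ k) := by
        refine sum_congr rfl fun t ht => prod_congr rfl fun k hk => ?_
        rw [hτx k ((mem_powersetCard.1 ht).1 hk)]
    _ = ∑ t ∈ powersetCard j s, ∏ k ∈ t.map τ.toEmbedding, x k := by
        refine sum_congr rfl fun t _ => ?_
        rw [prod_map]
        rfl
    _ = ∑ t ∈ (powersetCard j s).map (mapEmbedding τ.toEmbedding).toEmbedding,
          ∏ k ∈ t, x k := by
        rw [sum_map]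
        rfl
    _ = esy[x, s, j] := by rw [← powersetCard_map, hmap]

omit [DecidableEq α] in
/-- Under the same pairing, positive weights multiply to `1` over `s`. [this work; elementary] -/
theorem prod_eq_one_of_pairing (x : α → ℝ) (s : Finset α) (τ : Equiv.Perm α)
    (hτs : ∀ k ∈ s, τ k ∈ s) (hτx : ∀ k ∈ s, x (τ k) = (x k)⁻¹) (hpos : ∀ k ∈ s, 0 < x k) :
    ∏ k ∈ s, x k = 1 := by
  have hmap := map_perm_eq_self τ hτs
  have h1 : ∏ k ∈ s, x k = ∏ k ∈ s, (x k)⁻¹ := by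
    calc ∏ k ∈ s, x k = ∏ k ∈ s.map τ.toEmbedding, x k := by rw [hmap]
      _ = ∏ k ∈ s, x (τ k) := by rw [prod_map]; rfl
      _ = ∏ k ∈ s, (x k)⁻¹ := prod_congr rfl fun k hk => hτx k hk
  rw [prod_inv_distrib] at h1
  have hP : 0 < ∏ k ∈ s, x k := prod_pos hpos
  -- `P = P⁻¹`, `P > 0` ⇒ `P = 1`
  have h2 : (∏ k ∈ s, x k) * (∏ k ∈ s, x k) = 1 := by
    nth_rewrite 2 [h1]
    exact mul_inv_cancel₀ hP.ne'
  nlinarith [hP, h2, sq_nonneg ((∏ k ∈ s, x k) - 1)]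

/-- SYMMETRY OF THE NUMBER LAW: `e_{#s - j}(x; s) = e_j(x; s)` (`j ≤ #s`) for a positive weight
family inverted by a permutation of `s`. [this work; elementary] -/
theorem esy_card_sub_eq_of_pairing (x : α → ℝ) (s : Finset α) (τ : Equiv.Perm α)
    (hτs : ∀ k ∈ s, τ k ∈ s) (hτx : ∀ k ∈ s, x (τ k) = (x k)⁻¹) (hpos : ∀ k ∈ s, 0 < x k)
    {j : ℕ} (hj : j ≤ s.card) :
    esy[x, s, s.card - j] = esy[x, s, j] := by
  rw [esy_card_sub_eq x s (fun k hk => (hpos k hk).ne') hj, prod_eq_one_of_pairing x s τ hτs hτx hpos,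
    one_mul, esy_inv_eq_of_pairing x s τ hτs hτx]

/-- THE SYMMETRIC POINT: if `#s = 2(m₀+1)` then `e_{m₀}(x; s) = e_{m₀+2}(x; s)`, i.e.
`e_{m-1} = e_{m+1}` at `m = m₀ + 1 = #s/2` — hypothesis `hsym` of
`CanonicalOccupation.fugacity_window`. [this work; elementary] -/
theorem esy_symmetric_point (x : α → ℝ) (s : Finset α) (τ : Equiv.Perm α)
    (hτs : ∀ k ∈ s, τ k ∈ s) (hτx : ∀ k ∈ s, x (τ k) = (x k)⁻¹) (hpos : ∀ k ∈ s, 0 < x k)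
    {m₀ : ℕ} (hcard : s.card = 2 * (m₀ + 1)) :
    esy[x, s, m₀] = esy[x, s, m₀ + 2] := by
  have h := esy_card_sub_eq_of_pairing x s τ hτs hτx hpos (j := m₀ + 2) (by omega)
  have e1 : s.card - (m₀ + 2) = m₀ := by omega
  rw [e1] at h
  exact h

end Summit.HubbardSuperconductivity.HubbardSuperconductivity.Theorems.CanonicalOccupation
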